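import Literature.Analysis.Calculus.WhitneyEvenFunctionSeveral
import HarnessLib

/-!
# Parity normal form: a smooth function odd ∕ even under finitely many commuting reflections

Let `V` be a finite-dimensional real normed space, `ℓ_i ∈ V*`, `v_i ∈ V` a BIORTHOGONAL family
(`ℓ_i (v_j) = δ_ij`) indexed by two disjoint finite sets `O` (odd) and `Q` (even), and
`r_i (y) = y − 2 ℓ_i(y) v_i` the corresponding (commuting) reflections.  If `G : V → E` is `C^∞`,
odd under `r_i` for `i ∈ O` and even under `r_i` for `i ∈ Q`, then

  `G y = (∏_{i ∈ O} ℓ_i y) • H (y + ∑_{i ∈ O ∪ Q} ((ℓ_i y)² − ℓ_i y) • v_i)`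

with `H : V → E` smooth on the whole space — every reflection coordinate is divided out (odd ones)
and replaced by its square (`exists_contDiff_parity_normalForm`).

Road: (i) continuous functions equal off a hyperplane are equal; (ii) ODD STEP — Hadamard's lemma
in the straightened coordinate `g (t, y) = G (y − ℓ y • v + t • v)` (★ `WhitneyEvenFunction`:
`smul_integral_fderiv_fst_eq_sub`, `contDiff_integral_fderiv_fst`, `eq_zero_of_odd`) gives
`G = ℓ • A`, and `A` inherits every parity by (i); (iii) Finset induction over `O`;
(iv) EVEN STEP — in the coordinates `(ρ, z) ↦ (z − ∑ ℓ_i z • v_i) + ∑ ρ_i • v_i` the all-even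
function is Whitney's `U (ρ², z)` (★ `exists_contDiff_comp_sq_of_forall_even_fintype`), read back
on `V` through `ℓ_j (sq y) = (ℓ_j y)²`.

This is the parity normal form used to write a smooth germ with the wall parities of the
archimedean stable orbital integrals as a class function (W-road, brick (W2a)); pure calculus.

## References

* H. Whitney, *Differentiable even functions*, Duke Math. J. 10 (1943), 159–160, Thms. 1–2. [Whitney1943]
* J. Dieudonné, *Foundations of Modern Analysis* (1960), (3.15.2) (extension of identities). [Dieudonne1960]
* R. T. Seeley, Proc. AMS 15 (1964), 625–626 (through ★ `WhitneyEvenFunctionSeveral`). [Seeley1964]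
-/

noncomputable section

open Set Function Filter
open scoped Topology ContDiff

namespace Literature.Analysis.Calculus

universe u

variable {V E : Type u} [NormedAddCommGroup V] [NormedSpace ℝ V]
  [NormedAddCommGroup E] [NormedSpace ℝ E]

/-! ## §1 Equality off a hyperplane -/

omit [NormedSpace ℝ E] in
/-- Two continuous functions which agree off the hyperplane `{ℓ = 0}` (`ℓ ≠ 0`, witnessed by
`ℓ v = 1`) agree everywhere (extension of identities from the dense set `{ℓ ≠ 0}`).
[cite: Dieudonne1960, (3.15.2)] -/
theorem eq_of_forall_apply_ne_zero_eq (ℓ : V →L[ℝ] ℝ) {v : V} (hv : ℓ v = 1) {f g : V → E}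
    (hf : Continuous f) (hg : Continuous g) (h : ∀ y, ℓ y ≠ 0 → f y = g y) : f = g := by
  funext y
  by_cases hy : ℓ y ≠ 0
  · exact h y hy
  rw [not_ne_iff] at hy
  have hc : Continuous fun t : ℝ => y + t • v := by fun_prop
  have hlim : ∀ {k : V → E}, Continuous k →
      Tendsto (fun t : ℝ => k (y + t • v)) (𝓝[≠] 0) (𝓝 (k y)) := fun {k} hk => by
    have h0 := ((hk.comp hc).tendsto (0 : ℝ)).mono_left (nhdsWithin_le_nhds (s := {(0 : ℝ)}ᶜ))
    simpa [Function.comp_def] using h0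
  have heq : (fun t : ℝ => f (y + t • v)) =ᶠ[𝓝[≠] 0] fun t => g (y + t • v) :=
    eventually_nhdsWithin_of_forall fun t (ht : t ≠ 0) => h _ (by simpa [hv, hy] using ht)
  exact tendsto_nhds_unique ((hlim hf).congr' heq) (hlim hg)

/-- If `G = ℓ • A` with `A` continuous and `G ∘ r' = s • G` for a reflection
`r' y = y − 2 ℓ'(y) v'` with `ℓ (v') = 0`, then `A ∘ r' = s • A` (cancel `ℓ y` off the hyperplane,
extend by density). [cite: Dieudonne1960, (3.15.2)] -/
theorem comp_reflection_eq_smul_of_eq_smul (ℓ : V →L[ℝ] ℝ) {v : V} (hv : ℓ v = 1) {G A : V → E}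
    (hA : Continuous A) (hGA : ∀ y, G y = ℓ y • A y) {ℓ' : V →L[ℝ] ℝ} {v' : V} (hv' : ℓ v' = 0)
    {s : ℝ} (hG : ∀ y, G (y - (2 * ℓ' y) • v') = s • G y) :
    ∀ y, A (y - (2 * ℓ' y) • v') = s • A y := by
  have key : (fun y => A (y - (2 * ℓ' y) • v')) = fun y => s • A y := by
    refine eq_of_forall_apply_ne_zero_eq ℓ hv (hA.comp (by fun_prop)) (hA.const_smul s)
      fun y hy => ?_
    have hl : ℓ (y - (2 * ℓ' y) • v') = ℓ y := by simp [hv']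
    have h1 := hGA (y - (2 * ℓ' y) • v')
    rw [hl, hG y, hGA y, smul_comm] at h1
    exact (smul_right_injective E hy h1).symm
  exact fun y => congrFun key y

/-- If `G = ℓ • A` with `A` continuous and `G` is ODD under the reflection `r y = y − 2 ℓ(y) v`
itself, then `A` is EVEN under `r`. [cite: Dieudonne1960, (3.15.2)] [cite: Whitney1943, Thm. 2] -/
theorem comp_reflection_eq_self_of_eq_smul (ℓ : V →L[ℝ] ℝ) {v : V} (hv : ℓ v = 1) {G A : V → E}
    (hA : Continuous A) (hGA : ∀ y, G y = ℓ y • A y)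
    (hG : ∀ y, G (y - (2 * ℓ y) • v) = -G y) : ∀ y, A (y - (2 * ℓ y) • v) = A y := by
  have key : (fun y => A (y - (2 * ℓ y) • v)) = A := by
    refine eq_of_forall_apply_ne_zero_eq ℓ hv (hA.comp (by fun_prop)) hA fun y hy => ?_
    have hl : ℓ (y - (2 * ℓ y) • v) = -ℓ y := by simp [hv]; ring
    have h1 := hGA (y - (2 * ℓ y) • v)
    rw [hl, hG y, hGA y, neg_smul, neg_inj] at h1
    exact (smul_right_injective E hy h1).symm
  exact fun y => congrFun key y

/-! ## §2 The odd step (Hadamard) -/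

variable [FiniteDimensional ℝ V] [CompleteSpace E]

/-- **Odd step.** A smooth `G : V → E` which is odd under the reflection `y ↦ y − 2 ℓ(y) v`
(`ℓ v = 1`) is `ℓ • A` with `A` smooth: Hadamard's lemma in the straightened coordinate
`g (t, y) = G (y − ℓ y • v + t • v)`, `A y = (∫₀¹ ∂_t g (s ℓ y, y) ds)` (Whitney: «an odd function may be
written `x g(x²)`» — here only the division by `x`). [cite: Whitney1943, Thm. 2] -/
theorem exists_contDiff_eq_smul_of_odd (ℓ : V →L[ℝ] ℝ) {v : V} (hv : ℓ v = 1) {G : V → E}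
    (hG : ContDiff ℝ ∞ G) (hodd : ∀ y, G (y - (2 * ℓ y) • v) = -G y) :
    ∃ A : V → E, ContDiff ℝ ∞ A ∧ ∀ y, G y = ℓ y • A y := by
  let g : ℝ × V → E := fun p => G (p.2 - ℓ p.2 • v + p.1 • v)
  have hg : ContDiff ℝ ∞ g := hG.comp (by fun_prop)
  have hgodd : ∀ (t : ℝ) (y : V), g (-t, y) = -g (t, y) := by
    intro t y
    have h := hodd (y - ℓ y • v + t • v)
    have hl : ℓ (y - ℓ y • v + t • v) = t := by simp [hv]
    rw [hl] at h
    have hpt : y - ℓ y • v + t • v - (2 * t) • v = y - ℓ y • v + (-t) • v := by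
      rw [show (-t) = t - 2 * t by ring, sub_smul]; abel
    rw [hpt] at h
    exact h
  let a : ℝ × V → E := fun p =>
    ∫ s in (0 : ℝ)..1, fderiv ℝ g (s * p.1, p.2) ((1 : ℝ), (0 : V))
  have ha : ContDiff ℝ ∞ a := contDiff_integral_fderiv_fst hg
  have hga : ∀ (t : ℝ) (y : V), g (t, y) = t • a (t, y) := by
    intro t y
    have h := smul_integral_fderiv_fst_eq_sub (hg.of_le (by exact_mod_cast le_top)) t y
    rw [eq_zero_of_odd hgodd y, sub_zero] at h
    exact h.symm
  refine ⟨fun y => a (ℓ y, y), ha.comp (ℓ.contDiff.prodMk contDiff_id), fun y => ?_⟩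
  have hy : G y = g (ℓ y, y) := by
    show G y = G (y - ℓ y • v + ℓ y • v)
    rw [sub_add_cancel]
  rw [hy, hga]

/-! ## §3 All odd directions at once (Finset induction) -/

/-- **Odd product.** With biorthogonal data on `O' ∪ Q'`, a smooth `G` odd under `r_i`, `i ∈ O'`,
and even under `r_i`, `i ∈ Q'`, is `(∏_{i ∈ O'} ℓ_i) • H` with `H` smooth and EVEN under every
`r_i`, `i ∈ O' ∪ Q'`. [cite: Whitney1943, Thm. 2] -/
theorem exists_contDiff_eq_prod_smul_of_parity {κ : Type*} [DecidableEq κ]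
    (ℓ : κ → V →L[ℝ] ℝ) (v : κ → V) (O' : Finset κ) :
    ∀ (Q' : Finset κ), Disjoint O' Q' →
      (∀ i ∈ O' ∪ Q', ∀ j ∈ O' ∪ Q', ℓ i (v j) = if i = j then 1 else 0) →
      ∀ {G : V → E}, ContDiff ℝ ∞ G →
      (∀ i ∈ O', ∀ y, G (y - (2 * ℓ i y) • v i) = -G y) →
      (∀ i ∈ Q', ∀ y, G (y - (2 * ℓ i y) • v i) = G y) →
      ∃ H : V → E, ContDiff ℝ ∞ H ∧ (∀ i ∈ O' ∪ Q', ∀ y, H (y - (2 * ℓ i y) • v i) = H y) ∧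
        ∀ y, G y = (∏ i ∈ O', ℓ i y) • H y := by
  induction O' using Finset.induction_on with
  | empty =>
    intro Q' _ _ G hG _ hev
    exact ⟨G, hG, fun i hi y => hev i (by simpa using hi) y, fun y => by simp⟩
  | insert j O'' hj ih =>
    intro Q' hdisj hbi G hG hodd hev
    have hjmem : j ∈ insert j O'' ∪ Q' := by simp
    have hvj : ℓ j (v j) = 1 := by simpa using hbi j hjmem j hjmem
    obtain ⟨A, hA, hGA⟩ :=
      exists_contDiff_eq_smul_of_odd (ℓ j) hvj hG (hodd j (Finset.mem_insert_self _ _))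
    have hAc : Continuous A := hA.continuous
    -- parities inherited by `A`
    have hv0 : ∀ i ∈ insert j O'' ∪ Q', i ≠ j → ℓ j (v i) = 0 := fun i hi hij => by
      rw [hbi j hjmem i hi, if_neg (Ne.symm hij)]
    have hAj : ∀ y, A (y - (2 * ℓ j y) • v j) = A y :=
      comp_reflection_eq_self_of_eq_smul (ℓ j) hvj hAc hGA (hodd j (Finset.mem_insert_self _ _))
    have hAodd : ∀ i ∈ O'', ∀ y, A (y - (2 * ℓ i y) • v i) = -A y := by
      intro i hi y
      have hij : i ≠ j := fun h => hj (h ▸ hi)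
      have h := comp_reflection_eq_smul_of_eq_smul (ℓ j) hvj hAc hGA
        (hv0 i (by simp [hi]) hij) (s := -1)
        (fun y => by rw [neg_one_smul]; exact hodd i (Finset.mem_insert_of_mem hi) y) y
      rwa [neg_one_smul] at h
    have hAev : ∀ i ∈ insert j Q', ∀ y, A (y - (2 * ℓ i y) • v i) = A y := by
      intro i hi y
      rcases Finset.mem_insert.1 hi with rfl | hi'
      · exact hAj y
      · have hij : i ≠ j := fun h => by
          subst h
          exact Finset.disjoint_left.1 hdisj (Finset.mem_insert_self _ _) hi'
        have h := comp_reflection_eq_smul_of_eq_smul (ℓ j) hvj hAc hGA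
          (hv0 i (by simp [hi']) hij) (s := 1) (fun y => by rw [one_smul]; exact hev i hi' y) y
        rwa [one_smul] at h
    -- induction hypothesis on `A` with `Q'' := insert j Q'`
    have hdisj' : Disjoint O'' (insert j Q') := by
      rw [Finset.disjoint_insert_right]
      exact ⟨hj, (Finset.disjoint_insert_left.1 hdisj).2⟩
    have hsets : O'' ∪ insert j Q' = insert j O'' ∪ Q' := by
      ext i; simp
    have hbi' : ∀ i ∈ O'' ∪ insert j Q', ∀ i' ∈ O'' ∪ insert j Q',
        ℓ i (v i') = if i = i' then 1 else 0 := fun i hi i' hi' =>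
      hbi i (hsets ▸ hi) i' (hsets ▸ hi')
    obtain ⟨H, hH, hHev, hAH⟩ := ih (insert j Q') hdisj' hbi' hA hAodd hAev
    refine ⟨H, hH, fun i hi y => hHev i (hsets ▸ hi) y, fun y => ?_⟩
    rw [Finset.prod_insert hj, mul_smul, ← hAH y, hGA y]

/-! ## §4 The parity normal form -/

/-- **Parity normal form** (Hadamard ∘ Whitney-even ∘ Seeley, iterated over a finite commuting
family of reflections). Let `ℓ_i ∈ V*`, `v_i ∈ V` be biorthogonal on `O ∪ Q` (`O`, `Q` disjoint
finite sets) and `G : V → E` smooth, ODD under `y ↦ y − 2ℓ_i(y) v_i` for `i ∈ O` and EVEN for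
`i ∈ Q`. Then `G y = (∏_{i∈O} ℓ_i y) • H (y + ∑_{i ∈ O ∪ Q} ((ℓ_i y)² − ℓ_i y) • v_i)` with `H` smooth
on all of `V` — the argument of `H` is `y` with every reflection coordinate replaced by its SQUARE.
[cite: Whitney1943, Thm. 1, Thm. 2 and the Remark on several variables] [cite: Seeley1964, Theorem] -/
theorem exists_contDiff_parity_normalForm {κ : Type*} [DecidableEq κ] (O Q : Finset κ)
    (hOQ : Disjoint O Q) (ℓ : κ → V →L[ℝ] ℝ) (v : κ → V)
    (hbi : ∀ i ∈ O ∪ Q, ∀ j ∈ O ∪ Q, ℓ i (v j) = if i = j then 1 else 0)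
    {G : V → E} (hG : ContDiff ℝ ∞ G)
    (hodd : ∀ i ∈ O, ∀ y, G (y - (2 * ℓ i y) • v i) = -G y)
    (heven : ∀ i ∈ Q, ∀ y, G (y - (2 * ℓ i y) • v i) = G y) :
    ∃ H : V → E, ContDiff ℝ ∞ H ∧
      ∀ y, G y = (∏ i ∈ O, ℓ i y) • H (y + ∑ i ∈ O ∪ Q, ((ℓ i y) ^ 2 - ℓ i y) • v i) := by
  -- (1) divide out the odd coordinates
  obtain ⟨H₀, hH₀, hH₀ev, hGH₀⟩ :=
    exists_contDiff_eq_prod_smul_of_parity ℓ v O Q hOQ hbi hG hodd heven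
  -- (2) coordinates adapted to the reflections
  set I : Finset κ := O ∪ Q with hI
  let proj : V → V := fun z => z - ∑ i ∈ I, ℓ i z • v i
  let T : (↥I → ℝ) × V → V := fun p => proj p.2 + ∑ i : ↥I, p.1 i • v (i : κ)
  have hproj : ContDiff ℝ ∞ proj := by
    refine contDiff_id.sub (ContDiff.sum fun i _ => ?_)
    exact ((ℓ i).contDiff).smul contDiff_const
  have hT : ContDiff ℝ ∞ T := by
    refine (hproj.comp contDiff_snd).add (ContDiff.sum fun i _ => ?_)
    exact (((contDiff_apply ℝ ℝ i).comp contDiff_fst)).smul contDiff_const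
  -- biorthogonality bookkeeping
  have hℓsum : ∀ j ∈ I, ∀ c : κ → ℝ, ℓ j (∑ i ∈ I, c i • v i) = c j := by
    intro j hj c
    rw [map_sum]
    simp_rw [map_smul, smul_eq_mul]
    rw [Finset.sum_congr rfl fun i hi => by rw [hbi j hj i hi]]
    simp [Finset.sum_ite_eq, hj]
  have hℓproj : ∀ j ∈ I, ∀ z : V, ℓ j (proj z) = 0 := by
    intro j hj z
    show ℓ j (z - ∑ i ∈ I, ℓ i z • v i) = 0
    rw [map_sub, hℓsum j hj, sub_self]
  have hℓsub : ∀ j : ↥I, ∀ ρ : ↥I → ℝ, ℓ j (∑ i : ↥I, ρ i • v (i : κ)) = ρ j := by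
    intro j ρ
    rw [map_sum]
    simp_rw [map_smul, smul_eq_mul]
    rw [Finset.sum_eq_single j]
    · rw [hbi j j.2 j j.2, if_pos rfl, mul_one]
    · intro i _ hij
      rw [hbi j j.2 i i.2, if_neg (fun h => hij (Subtype.ext h).symm), mul_zero]
    · intro h; exact absurd (Finset.mem_univ j) h
  have hℓT : ∀ (j : ↥I) (ρ : ↥I → ℝ) (z : V), ℓ j (T (ρ, z)) = ρ j := by
    intro j ρ z
    show ℓ j (proj z + ∑ i : ↥I, ρ i • v (i : κ)) = ρ j
    rw [map_add, hℓproj j j.2, zero_add, hℓsub]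
  have hsum_update : ∀ (ρ : ↥I → ℝ) (j : ↥I) (c : ℝ),
      ∑ i : ↥I, update ρ j c i • v (i : κ) = ∑ i : ↥I, ρ i • v (i : κ) + (c - ρ j) • v (j : κ) := by
    intro ρ j c
    have hfun : (fun i : ↥I => update ρ j c i • v (i : κ)) =
        fun i => ρ i • v (i : κ) + (if i = j then (c - ρ j) • v (j : κ) else 0) := by
      funext i
      by_cases h : i = j
      · subst h
        rw [update_self, if_pos rfl, ← add_smul]
        ring_nf
      · rw [update_of_ne h, if_neg h, add_zero]
    rw [hfun, Finset.sum_add_distrib, Finset.sum_ite_eq' Finset.univ j,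
      if_pos (Finset.mem_univ _)]
  have hTrefl : ∀ (j : ↥I) (ρ : ↥I → ℝ) (z : V),
      T (update ρ j (-ρ j), z) = T (ρ, z) - (2 * ℓ j (T (ρ, z))) • v (j : κ) := by
    intro j ρ z
    rw [hℓT]
    show proj z + ∑ i : ↥I, update ρ j (-ρ j) i • v (i : κ) =
      proj z + ∑ i : ↥I, ρ i • v (i : κ) - (2 * ρ j) • v (j : κ)
    rw [hsum_update, show (-ρ j - ρ j) = -(2 * ρ j) by ring, neg_smul]
    abel
  -- (3) the all-even function in coordinates, and Whitney
  let F : (↥I → ℝ) × V → E := fun p => H₀ (T p)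
  have hF : ContDiff ℝ ∞ F := hH₀.comp hT
  have hFev : ∀ (j : ↥I) (ρ : ↥I → ℝ) (z : V), F (update ρ j (-ρ j), z) = F (ρ, z) := by
    intro j ρ z
    show H₀ (T (update ρ j (-ρ j), z)) = H₀ (T (ρ, z))
    rw [hTrefl, hH₀ev j j.2]
  obtain ⟨U, hU, hFU, -⟩ := exists_contDiff_comp_sq_of_forall_even_fintype F hF hFev
  -- (4) read back on `V`
  refine ⟨fun y => U (fun i : ↥I => ℓ i y, proj y), ?_, fun y => ?_⟩
  · exact hU.comp ((contDiff_pi.2 fun i : ↥I => (ℓ (i : κ)).contDiff).prodMk hproj)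
  · have hprojproj : ∀ z : V, proj (proj z) = proj z := by
      intro z
      show proj z - ∑ i ∈ I, ℓ i (proj z) • v i = proj z
      rw [Finset.sum_eq_zero fun i hi => by rw [hℓproj i hi, zero_smul], sub_zero]
    have hTy : T ((fun i : ↥I => ℓ i y), proj y) = y := by
      show proj (proj y) + ∑ i : ↥I, ℓ (i : κ) y • v (i : κ) = y
      rw [hprojproj, Finset.sum_coe_sort I (fun i => ℓ i y • v i)]
      show (y - ∑ i ∈ I, ℓ i y • v i) + ∑ i ∈ I, ℓ i y • v i = y
      abel
    -- the squared point `y' = sq y`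
    set y' : V := y + ∑ i ∈ I, ((ℓ i y) ^ 2 - ℓ i y) • v i with hy'
    have hℓy' : ∀ j ∈ I, ℓ j y' = (ℓ j y) ^ 2 := by
      intro j hj
      rw [hy', map_add, hℓsum j hj]
      ring
    have hprojy' : proj y' = proj y := by
      show y' - ∑ i ∈ I, ℓ i y' • v i = y - ∑ i ∈ I, ℓ i y • v i
      rw [Finset.sum_congr rfl fun i hi => by rw [hℓy' i hi], hy', sub_eq_iff_eq_add]
      simp only [sub_smul, Finset.sum_sub_distrib]
      abel
    rw [hGH₀ y]
    congr 1
    show H₀ y = U (fun i : ↥I => ℓ i y', proj y')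
    calc H₀ y = H₀ (T ((fun i : ↥I => ℓ i y), proj y)) := by rw [hTy]
      _ = F ((fun i : ↥I => ℓ i y), proj y) := rfl
      _ = U (fun i : ↥I => (ℓ i y) ^ 2, proj y) := hFU _ _
      _ = U (fun i : ↥I => ℓ i y', proj y') :=
          congrArg U (Prod.ext (funext fun i => (hℓy' i i.2).symm) hprojy'.symm)

end Literature.Analysis.Calculus

end
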